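import Summits.Parity.BatemanHorn.Theorems.SystemLSDRealSegment.Negative.LoadBearing

/-!
# Stub S1 `stub_farMoment` of line `smooth-rough-lattice-acquisition` — `leadingCoeff_pos` and `hasNoFixedPrimeDivisor` are NOT load-bearing

Small-model facts (refuter, drefute gen 2, 2026-08-16) for the shared anatomy stub S1 = `FarMomentAlongSystem` of the line
`Cruxes/SystemZeroRepulsion/Lines/smooth-rough-lattice-acquisition.lean` (crux stmt-Parity-11291,
`Summit.Parity.BatemanHorn.Theses.AlmostPrimeZeros.SystemZeroRepulsion`; also card far-zone-hardy-ramanujan-along-f):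

  S1  `∀ (k,f) BH, ∃ C, ∀ x ≥ 3, ∀ t ∈ [1, √log x], Σ_{n≤x} t^{s_f(n)} ≤ (x+1)·exp(C t log log x)`.

Its CONCLUSION holds for the two junk models through which `leadingCoeff_pos` resp. `hasNoFixedPrimeDivisor` could bite:
`![-X]` (statistic `≡ 0` by `Int.toNat`; `C = 0`) and the constant prime `![C 3]` (statistic `≡ 1`; `C = 1/log log 3`, using
`log log x ≥ log log 3 > 0` for `x ≥ 3` and `e^t ≥ 1 + t`). So — in contrast with stubs S4 and S6 of the same line
(`StubRoughMajorantLoadBearing.lean`, `StubSmoothPeriodicFactorisationLoadBearing.lean`), where all four fields of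
`IsBatemanHornSystem` are load-bearing as typed — a proof of S1 can only consume `irreducible` / `pairwise_not_associated`
(which ARE load-bearing for the RANGE `t ≤ √log x`: `X²`, `(X,X)` give `Σ_n (log x)^{ω(n)} = x·exp((2+o(1)) log x·log₃x/log₂x) ≫
(x+1)e^{C√(log x) log₂x}` — paper, not formalised here). Natural hypothesis class of S1: each `f_i` non-constant, `∏ f_i` squarefree.
-/

noncomputable section

open Filter Polynomial Finset
open scoped Topology

namespace Summit.Parity.BatemanHorn.Theorems.SystemZeroRepulsion.Negative

open Literature.NumberTheory.Sieve
open Summit.Parity.BatemanHorn.Theorems.SystemLSDRealSegment.Negative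

/-- The conclusion of S1 HOLDS for `![-X]` (with `C = 0`): every weight is `t⁰ = 1`, the sum is `x + 1`. [folklore] -/
theorem stubFarMoment_conclusion_negX :
    ∃ C : ℝ, ∀ x : ℕ, 3 ≤ x → ∀ t : ℝ, 1 ≤ t → t ≤ Real.sqrt (Real.log (x : ℝ)) →
      (∑ n ∈ Finset.range (x + 1), (t : ℝ) ^ (∑ i, ((((![-X] : Fin 1 → ℤ[X]) i).eval (n : ℤ)).toNat.factorization.sum
        fun _ v => min v 2))) ≤ ((x : ℝ) + 1) * Real.exp (C * t * Real.log (Real.log (x : ℝ))) := by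
  refine ⟨0, fun x _ t _ _ => ?_⟩
  simp only [stat_negX, pow_zero, Finset.sum_const, Finset.card_range, nsmul_eq_mul, mul_one, zero_mul,
    Real.exp_zero]
  push_cast
  exact le_rfl

/-- `0 < log log 3` (`3 > e`). [folklore] -/
theorem loglog_three_pos : 0 < Real.log (Real.log 3) := by
  apply Real.log_pos
  rw [← Real.log_exp 1]
  refine Real.log_lt_log (Real.exp_pos 1) ?_
  have := Real.exp_one_lt_d9
  linarith

/-- The conclusion of S1 HOLDS for the constant prime `![C 3]` (with `C = 1/log log 3`): every weight is `t¹`, and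
`t ≤ 1 + t ≤ e^{t} ≤ e^{C t log log x}` since `log log x ≥ log log 3` for `x ≥ 3`. [folklore] -/
theorem stubFarMoment_conclusion_C_three :
    ∃ C : ℝ, ∀ x : ℕ, 3 ≤ x → ∀ t : ℝ, 1 ≤ t → t ≤ Real.sqrt (Real.log (x : ℝ)) →
      (∑ n ∈ Finset.range (x + 1), (t : ℝ) ^ (∑ i, ((((![(Polynomial.C 3 : ℤ[X])] : Fin 1 → ℤ[X]) i).eval (n : ℤ)).toNat.factorization.sum
        fun _ v => min v 2))) ≤ ((x : ℝ) + 1) * Real.exp (C * t * Real.log (Real.log (x : ℝ))) := by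
  set ℓ : ℝ := Real.log (Real.log 3) with hℓ
  have hℓ0 : 0 < ℓ := loglog_three_pos
  refine ⟨1 / ℓ, fun x hx t ht _ => ?_⟩
  simp only [stat_C_three, pow_one, Finset.sum_const, Finset.card_range, nsmul_eq_mul]
  push_cast
  have hx3 : (3 : ℝ) ≤ x := by exact_mod_cast hx
  have hL : ℓ ≤ Real.log (Real.log (x : ℝ)) := by
    have h1 : Real.log 3 ≤ Real.log (x : ℝ) := Real.log_le_log (by norm_num) hx3
    have h3 : 0 < Real.log 3 := Real.log_pos (by norm_num)
    exact Real.log_le_log h3 h1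
  have ht0 : 0 ≤ t := by linarith
  have hexp : t ≤ Real.exp (1 / ℓ * t * Real.log (Real.log (x : ℝ))) := by
    have h1 : t ≤ 1 / ℓ * t * Real.log (Real.log (x : ℝ)) := by
      calc t = 1 / ℓ * t * ℓ := by field_simp
        _ ≤ 1 / ℓ * t * Real.log (Real.log (x : ℝ)) := by
            exact mul_le_mul_of_nonneg_left hL (by positivity)
    have h2 := Real.add_one_le_exp (1 / ℓ * t * Real.log (Real.log (x : ℝ)))
    linarith
  have hx0 : (0 : ℝ) ≤ (x : ℝ) + 1 := by positivity
  exact mul_le_mul_of_nonneg_left hexp hx0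

end Summit.Parity.BatemanHorn.Theorems.SystemZeroRepulsion.Negative
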